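import Mathlib
import HarnessLib

/-!
# Route `IntegerScrew` — the Laplace transform of THEOREM C's window law `g` in closed form
# (PROPOSITION R, CONTINUUM-LIMIT §23.2; the γ-free form of §6.1 used by THEOREM N6₂ (a))

CONTINUUM-LIMIT §23.2 (rh-explicit A6-PIVOT theory; PIVOT-LAW 13.51) computes the Laplace transform of THEOREM C's
return law `g(τ) = (1 − e^{−2τ})/τ − (1 − e^{−τ})²/τ² = ∫₀²|1−λ|e^{−τλ}dλ` in closed form:

  `T₁(z) := ∫₀^∞ e^{−zτ} g(τ) dτ = log((z+2)/z) − [(z+2)log(z+2) − 2(z+1)log(z+1) + z log z]`   (`z > 0`),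

whose expansion `log(1/z) − log 2 + z(3/2 − log 2 − log z) + O(z²log(1/z))` is the window half of PROPOSITION R and,
at leading order, §6.1's `∫₀^∞e^{−ετ}g = log(1/ε) − log 2 + o(1)` — the input of THEOREM N6₂ (a)'s `J₃` — WITHOUT Euler's
constant (the `γ₀` of `D_g = γ₀ − log 2` cancels against `e^{z}E₁(z)`'s).  This file proves the closed form in the kernel:

* `integral_frullani_exp` : `∫₀^∞ e^{−zτ}(1 − e^{−aτ})/τ dτ = log((z+a)/z)` (`z > 0`, `a ≥ 0`) — Frullani, by
  differentiating under the integral sign in `a` (`hasDerivAt_integral_of_dominated_loc_of_deriv_le`) and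
  `∫₀^∞e^{−(z+a)τ}dτ = 1/(z+a)`;
* `integral_frullani_sq` : `∫₀^∞ e^{−zτ}(1 − e^{−aτ})²/τ² dτ = (z+2a)log(z+2a) − 2(z+a)log(z+a) + z log z`
  (`z > 0`, `a ≥ 0`) — once more under the integral sign, the derivative being `2·`Frullani;
* `integral_exp_mul_window_eq` : the displayed `T₁(z)`.

Real analysis only (no walk, no primes); RH-free; nothing here bears on the truth of RH.  The identification of the
integrand with `IntegerScrewHarmonicKDefs.ccpg` (`ccpg u = (u − 1 + 2e^{−u} − (1+u)e^{−2u})/u²`) is one `field_simp`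
and is left to the file that imports both.  References: CONTINUUM-LIMIT §6.1, §19.3, §23.2; PIVOT-LAW 13.51;
M. Suzuki, J. Lond. Math. Soc. (2) 108 (2023) 1448–1487 [Suzuki2023] for the screw matrices this serves.
-/

noncomputable section

-- D-0017: `Summit.<S>.<S>.…` is the designed namespace of a single-problem summit.
set_option linter.dupNamespace false

namespace Summit.RiemannHypothesis.RiemannHypothesis.Theorems.IntegerScrew

open Real MeasureTheory Set Filter Topology intervalIntegral

/-! ## Elementary bounds on `1 − e^{−x}` -/

/-- `0 ≤ 1 − e^{−x} ≤ x` for `x ≥ 0`. -/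
theorem one_sub_exp_neg_mem {x : ℝ} (hx : 0 ≤ x) : 0 ≤ 1 - Real.exp (-x) ∧ 1 - Real.exp (-x) ≤ x := by
  constructor
  · rw [sub_nonneg]; exact Real.exp_le_one_iff.mpr (by linarith)
  · linarith [Real.add_one_le_exp (-x)]

/-- `|1 − e^{−x}| ≤ |x|·e^{|x|}` for every real `x`. -/
theorem abs_one_sub_exp_neg_le (x : ℝ) : |1 - Real.exp (-x)| ≤ |x| * Real.exp |x| := by
  rcases le_or_gt 0 x with hx | hx
  · obtain ⟨h0, h1⟩ := one_sub_exp_neg_mem hx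
    rw [abs_of_nonneg h0, abs_of_nonneg hx]
    have h2 : (1 : ℝ) ≤ Real.exp x := Real.one_le_exp_iff.mpr hx
    nlinarith
  · have h1 : 1 - Real.exp (-x) < 0 := by
      rw [sub_neg]; exact Real.one_lt_exp_iff.mpr (by linarith)
    rw [abs_of_neg h1, abs_of_neg hx]
    have hex : Real.exp x * Real.exp (-x) = 1 := by rw [← Real.exp_add, add_neg_cancel, Real.exp_zero]
    have h3 := Real.add_one_le_exp x
    nlinarith [Real.exp_pos (-x), Real.exp_pos x]

/-! ## The Frullani integrand `F(b,τ) = e^{−zτ}(1 − e^{−bτ})/τ`: derivative, measurability, integrability -/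

/-- `∂_b F(b,τ) = e^{−zτ}e^{−bτ}` for `τ ≠ 0`. -/
theorem hasDerivAt_frullani_integrand (z : ℝ) {τ : ℝ} (hτ : τ ≠ 0) (a : ℝ) :
    HasDerivAt (fun b : ℝ => Real.exp (-(z * τ)) * (1 - Real.exp (-(b * τ))) / τ)
      (Real.exp (-(z * τ)) * Real.exp (-(a * τ))) a := by
  have h1 : HasDerivAt (fun b : ℝ => -(b * τ)) (-τ) a :=
    ((hasDerivAt_id' a).mul_const τ).fun_neg.congr_deriv (by ring)
  have h2 : HasDerivAt (fun b : ℝ => 1 - Real.exp (-(b * τ))) (-(Real.exp (-(a * τ)) * -τ)) a :=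
    (h1.exp).const_sub 1
  have h3 := (h2.const_mul (Real.exp (-(z * τ)))).div_const τ
  refine h3.congr_deriv ?_
  field_simp

/-- The Frullani integrand is continuous on `(0, ∞)` in `τ`, for every `b`. -/
theorem continuousOn_frullani_integrand (z b : ℝ) :
    ContinuousOn (fun τ : ℝ => Real.exp (-(z * τ)) * (1 - Real.exp (-(b * τ))) / τ) (Ioi 0) := by
  refine ContinuousOn.div (by fun_prop) continuousOn_id fun τ hτ => (ne_of_gt hτ)
  
/-- For `b ≥ 0`, `|F(b,τ)| ≤ b·e^{−zτ}` on `τ > 0`. -/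
theorem norm_frullani_integrand_le {z b τ : ℝ} (hb : 0 ≤ b) (hτ : 0 < τ) :
    ‖Real.exp (-(z * τ)) * (1 - Real.exp (-(b * τ))) / τ‖ ≤ b * Real.exp (-(z * τ)) := by
  obtain ⟨h0, h1⟩ := one_sub_exp_neg_mem (mul_nonneg hb hτ.le)
  rw [Real.norm_eq_abs, abs_div, abs_mul, abs_of_pos (Real.exp_pos _), abs_of_nonneg h0, abs_of_pos hτ,
    div_le_iff₀ hτ]
  have := Real.exp_pos (-(z * τ))
  nlinarith

/-- For `b ≥ 0` and `z > 0`, `F(b,·)` is integrable on `(0, ∞)`. -/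
theorem integrableOn_frullani_integrand {z : ℝ} (hz : 0 < z) {b : ℝ} (hb : 0 ≤ b) :
    IntegrableOn (fun τ : ℝ => Real.exp (-(z * τ)) * (1 - Real.exp (-(b * τ))) / τ) (Ioi 0) := by
  have hbound : IntegrableOn (fun τ : ℝ => b * Real.exp (-z * τ)) (Ioi 0) :=
    (integrableOn_exp_mul_Ioi (by linarith : -z < 0) 0).const_mul b
  refine Integrable.mono' hbound
    ((continuousOn_frullani_integrand z b).aestronglyMeasurable measurableSet_Ioi) ?_
  refine (ae_restrict_mem measurableSet_Ioi).mono fun τ hτ => ?_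
  have := norm_frullani_integrand_le (z := z) hb hτ
  simpa [neg_mul] using this

/-- **Frullani with a parameter.** For `z > 0` and `b₀ ≥ 0`, `b ↦ ∫₀^∞ F(b,τ)dτ` has derivative `1/(z + b₀)` at `b₀`. -/
theorem hasDerivAt_frullani {z : ℝ} (hz : 0 < z) {b₀ : ℝ} (hb₀ : 0 ≤ b₀) :
    HasDerivAt (fun b : ℝ => ∫ τ in Ioi (0 : ℝ), Real.exp (-(z * τ)) * (1 - Real.exp (-(b * τ))) / τ)
      (1 / (z + b₀)) b₀ := by
  have hs : Ioo (-(z / 2)) (b₀ + 1) ∈ 𝓝 b₀ := Ioo_mem_nhds (by linarith) (by linarith)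
  have key := hasDerivAt_integral_of_dominated_loc_of_deriv_le (μ := volume.restrict (Ioi (0 : ℝ)))
    (F := fun b τ => Real.exp (-(z * τ)) * (1 - Real.exp (-(b * τ))) / τ)
    (F' := fun b τ => Real.exp (-(z * τ)) * Real.exp (-(b * τ))) (x₀ := b₀)
    (bound := fun τ => Real.exp (-(z / 2) * τ)) hs
    (Eventually.of_forall fun b => (continuousOn_frullani_integrand z b).aestronglyMeasurable measurableSet_Ioi)
    (integrableOn_frullani_integrand hz hb₀)
    ((by fun_prop : Continuous fun τ : ℝ => Real.exp (-(z * τ)) * Real.exp (-(b₀ * τ))).aestronglyMeasurable)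
    ?_ (integrableOn_exp_mul_Ioi (by linarith : -(z / 2) < 0) 0) ?_
  · -- the value of ∫ F'(b₀, τ) dτ
    have hval : ∫ τ in Ioi (0 : ℝ), Real.exp (-(z * τ)) * Real.exp (-(b₀ * τ)) = 1 / (z + b₀) := by
      have e : (fun τ : ℝ => Real.exp (-(z * τ)) * Real.exp (-(b₀ * τ))) = fun τ => Real.exp (-(z + b₀) * τ) := by
        funext τ; rw [← Real.exp_add]; ring_nf
      rw [e, integral_exp_mul_Ioi (by linarith : -(z + b₀) < 0) 0]
      have : z + b₀ ≠ 0 := by linarith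
      field_simp
      simp
    rw [hval] at key
    exact key.2
  · -- the uniform bound on F' over the neighbourhood
    refine (ae_restrict_mem measurableSet_Ioi).mono fun τ hτ b hb => ?_
    rw [Real.norm_eq_abs, abs_of_pos (mul_pos (Real.exp_pos _) (Real.exp_pos _)), ← Real.exp_add]
    have hτ0 : 0 < τ := mem_Ioi.mp hτ
    exact Real.exp_le_exp.mpr (by nlinarith [hb.1, hτ0])
  · -- pointwise differentiability in b for τ > 0
    refine (ae_restrict_mem measurableSet_Ioi).mono fun τ hτ b _ => ?_
    exact hasDerivAt_frullani_integrand z (ne_of_gt hτ) b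

/-- **Frullani.** `∫₀^∞ e^{−zτ}(1 − e^{−aτ})/τ dτ = log((z+a)/z)` for `z > 0`, `a ≥ 0`. -/
theorem integral_frullani_exp {z : ℝ} (hz : 0 < z) {a : ℝ} (ha : 0 ≤ a) :
    ∫ τ in Ioi (0 : ℝ), Real.exp (-(z * τ)) * (1 - Real.exp (-(a * τ))) / τ = Real.log ((z + a) / z) := by
  set Φ : ℝ → ℝ := fun b => ∫ τ in Ioi (0 : ℝ), Real.exp (-(z * τ)) * (1 - Real.exp (-(b * τ))) / τ with hΦ
  have hΦ0 : Φ 0 = 0 := by simp [hΦ]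
  -- FTC for Φ on [0, a]
  have hderiv : ∀ b ∈ uIcc (0 : ℝ) a, HasDerivAt Φ (1 / (z + b)) b := by
    intro b hb
    rw [uIcc_of_le ha] at hb
    exact hasDerivAt_frullani hz hb.1
  have hcont : ContinuousOn (fun b : ℝ => 1 / (z + b)) (uIcc 0 a) := by
    rw [uIcc_of_le ha]
    exact ContinuousOn.div continuousOn_const (continuousOn_const.add continuousOn_id)
      fun b hb => by have := hb.1; linarith
  have hFTC := integral_eq_sub_of_hasDerivAt hderiv (hcont.intervalIntegrable)
  -- the same integral by the antiderivative log(z + b)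
  have hlog : ∫ b in (0 : ℝ)..a, 1 / (z + b) = Real.log (z + a) - Real.log (z + 0) := by
    refine integral_eq_sub_of_hasDerivAt (f := fun b : ℝ => Real.log (z + b)) (fun b hb => ?_)
      (hcont.intervalIntegrable)
    rw [uIcc_of_le ha] at hb
    have hpos : z + b ≠ 0 := by have := hb.1; linarith
    have h := ((hasDerivAt_id' b).const_add z).log hpos
    simpa using h
  have : Φ a = Real.log (z + a) - Real.log z := by
    have := hFTC; rw [hlog, hΦ0, add_zero] at this; linarith
  rw [show (∫ τ in Ioi (0 : ℝ), Real.exp (-(z * τ)) * (1 - Real.exp (-(a * τ))) / τ) = Φ a from rfl, this,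
    Real.log_div (by linarith) hz.ne']

/-! ## The squared Frullani integral `G(b) = ∫₀^∞ e^{−zτ}(1 − e^{−bτ})²/τ² dτ` -/

/-- `∂_b [e^{−zτ}(1 − e^{−bτ})²/τ²] = 2e^{−zτ}(1 − e^{−bτ})e^{−bτ}/τ` for `τ ≠ 0`. -/
theorem hasDerivAt_frullaniSq_integrand (z : ℝ) {τ : ℝ} (hτ : τ ≠ 0) (a : ℝ) :
    HasDerivAt (fun b : ℝ => Real.exp (-(z * τ)) * (1 - Real.exp (-(b * τ))) ^ 2 / τ ^ 2)
      (2 * Real.exp (-(z * τ)) * (1 - Real.exp (-(a * τ))) * Real.exp (-(a * τ)) / τ) a := by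
  have h1 : HasDerivAt (fun b : ℝ => -(b * τ)) (-τ) a :=
    ((hasDerivAt_id' a).mul_const τ).fun_neg.congr_deriv (by ring)
  have h2 : HasDerivAt (fun b : ℝ => 1 - Real.exp (-(b * τ))) (-(Real.exp (-(a * τ)) * -τ)) a :=
    (h1.exp).const_sub 1
  have h3 := ((h2.pow 2).const_mul (Real.exp (-(z * τ)))).div_const (τ ^ 2)
  refine h3.congr_deriv ?_
  field_simp
  ring

/-- The squared integrand is continuous on `(0, ∞)` in `τ`. -/
theorem continuousOn_frullaniSq_integrand (z b : ℝ) :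
    ContinuousOn (fun τ : ℝ => Real.exp (-(z * τ)) * (1 - Real.exp (-(b * τ))) ^ 2 / τ ^ 2) (Ioi 0) := by
  refine ContinuousOn.div (by fun_prop) (by fun_prop) fun τ hτ => pow_ne_zero 2 (ne_of_gt hτ)

/-- Its `b`-derivative is continuous on `(0, ∞)` in `τ`. -/
theorem continuousOn_frullaniSq_deriv (z b : ℝ) :
    ContinuousOn (fun τ : ℝ => 2 * Real.exp (-(z * τ)) * (1 - Real.exp (-(b * τ))) * Real.exp (-(b * τ)) / τ)
      (Ioi 0) := by
  refine ContinuousOn.div (by fun_prop) continuousOn_id fun τ hτ => (ne_of_gt hτ)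

/-- For `b ≥ 0`, `|e^{−zτ}(1 − e^{−bτ})²/τ²| ≤ b²·e^{−zτ}` on `τ > 0`. -/
theorem norm_frullaniSq_integrand_le {z b τ : ℝ} (hb : 0 ≤ b) (hτ : 0 < τ) :
    ‖Real.exp (-(z * τ)) * (1 - Real.exp (-(b * τ))) ^ 2 / τ ^ 2‖ ≤ b ^ 2 * Real.exp (-(z * τ)) := by
  obtain ⟨h0, h1⟩ := one_sub_exp_neg_mem (mul_nonneg hb hτ.le)
  have hτ2 : 0 < τ ^ 2 := by positivity
  rw [Real.norm_eq_abs, abs_of_nonneg (by positivity), div_le_iff₀ hτ2]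
  have he := Real.exp_pos (-(z * τ))
  have hsq : (1 - Real.exp (-(b * τ))) ^ 2 ≤ (b * τ) ^ 2 := pow_le_pow_left₀ h0 h1 2
  nlinarith

/-- For `z > 0`, `b ≥ 0`, the squared integrand is integrable on `(0, ∞)`. -/
theorem integrableOn_frullaniSq_integrand {z : ℝ} (hz : 0 < z) {b : ℝ} (hb : 0 ≤ b) :
    IntegrableOn (fun τ : ℝ => Real.exp (-(z * τ)) * (1 - Real.exp (-(b * τ))) ^ 2 / τ ^ 2) (Ioi 0) := by
  have hbound : IntegrableOn (fun τ : ℝ => b ^ 2 * Real.exp (-z * τ)) (Ioi 0) :=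
    (integrableOn_exp_mul_Ioi (by linarith : -z < 0) 0).const_mul (b ^ 2)
  refine Integrable.mono' hbound
    ((continuousOn_frullaniSq_integrand z b).aestronglyMeasurable measurableSet_Ioi) ?_
  refine (ae_restrict_mem measurableSet_Ioi).mono fun τ hτ => ?_
  have := norm_frullaniSq_integrand_le (z := z) hb hτ
  simpa [neg_mul] using this

/-- The uniform bound on the `b`-derivative over `b ∈ (−z/4, B]`, `B ≥ 0`: `≤ (2B + z)·e^{−(z/2)τ}` on `τ > 0`. -/
theorem norm_frullaniSq_deriv_le {z : ℝ} (hz : 0 < z) {B b τ : ℝ} (hB : 0 ≤ B) (hb : -(z / 4) < b) (hbB : b ≤ B)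
    (hτ : 0 < τ) :
    ‖2 * Real.exp (-(z * τ)) * (1 - Real.exp (-(b * τ))) * Real.exp (-(b * τ)) / τ‖
      ≤ (2 * B + z) * Real.exp (-(z / 2) * τ) := by
  have hez := Real.exp_pos (-(z * τ))
  have heb := Real.exp_pos (-(b * τ))
  have hhalf : Real.exp (-(z * τ)) ≤ Real.exp (-(z / 2) * τ) := Real.exp_le_exp.mpr (by nlinarith)
  have hhalf0 := Real.exp_pos (-(z / 2) * τ)
  rw [Real.norm_eq_abs, abs_div, abs_of_pos hτ, div_le_iff₀ hτ, abs_mul, abs_of_pos heb, abs_mul,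
    abs_mul, abs_of_pos hez, abs_two]
  rcases le_or_gt 0 b with hb0 | hb0
  · -- b ≥ 0: |1 − e^{−bτ}| ≤ bτ ≤ Bτ, e^{−bτ} ≤ 1
    obtain ⟨h0, h1⟩ := one_sub_exp_neg_mem (mul_nonneg hb0 hτ.le)
    rw [abs_of_nonneg h0]
    have heb1 : Real.exp (-(b * τ)) ≤ 1 := Real.exp_le_one_iff.mpr (by nlinarith)
    have h3 : 2 * Real.exp (-(z * τ)) * (1 - Real.exp (-(b * τ))) * Real.exp (-(b * τ)) ≤
        2 * Real.exp (-(z / 2) * τ) * (B * τ) * 1 := by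
      gcongr
      nlinarith
    have h4 : 0 ≤ z * Real.exp (-(z / 2) * τ) * τ := by positivity
    nlinarith [h3, h4]
  · -- −z/4 < b < 0: |1 − e^{−bτ}| ≤ |b|τe^{|b|τ}, e^{−bτ} = e^{|b|τ}; e^{−zτ}e^{2|b|τ} ≤ e^{−(z/2)τ}
    have habs : |1 - Real.exp (-(b * τ))| ≤ |b| * τ * Real.exp (|b| * τ) := by
      have := abs_one_sub_exp_neg_le (b * τ)
      rwa [abs_mul, abs_of_pos hτ, show |b| * τ = |b| * τ by rfl] at this
    have hbabs : |b| = -b := abs_of_neg hb0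
    rw [hbabs] at habs
    have hprod : Real.exp (-(z * τ)) * Real.exp (-b * τ) * Real.exp (-(b * τ)) ≤ Real.exp (-(z / 2) * τ) := by
      rw [← Real.exp_add, ← Real.exp_add]
      exact Real.exp_le_exp.mpr (by nlinarith)
    have hb4 : -b < z / 4 := by linarith
    calc 2 * Real.exp (-(z * τ)) * |1 - Real.exp (-(b * τ))| * Real.exp (-(b * τ))
        ≤ 2 * Real.exp (-(z * τ)) * (-b * τ * Real.exp (-b * τ)) * Real.exp (-(b * τ)) := by
          gcongr
      _ = 2 * (-b) * τ * (Real.exp (-(z * τ)) * Real.exp (-b * τ) * Real.exp (-(b * τ))) := by ring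
      _ ≤ 2 * (-b) * τ * Real.exp (-(z / 2) * τ) := by
          have : 0 ≤ 2 * (-b) * τ := by nlinarith
          exact mul_le_mul_of_nonneg_left hprod this
      _ ≤ (2 * B + z) * Real.exp (-(z / 2) * τ) * τ := by
          have h5 : 2 * (-b) ≤ 2 * B + z := by linarith
          have h6 := mul_le_mul_of_nonneg_right h5 (mul_pos hhalf0 hτ).le
          nlinarith [h6]

/-- **The squared Frullani with a parameter.** For `z > 0`, `b₀ ≥ 0`:
`b ↦ ∫₀^∞ e^{−zτ}(1−e^{−bτ})²/τ² dτ` has derivative `2·log((z + 2b₀)/(z + b₀))` at `b₀`. -/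
theorem hasDerivAt_frullaniSq {z : ℝ} (hz : 0 < z) {b₀ : ℝ} (hb₀ : 0 ≤ b₀) :
    HasDerivAt (fun b : ℝ => ∫ τ in Ioi (0 : ℝ), Real.exp (-(z * τ)) * (1 - Real.exp (-(b * τ))) ^ 2 / τ ^ 2)
      (2 * Real.log ((z + 2 * b₀) / (z + b₀))) b₀ := by
  have hs : Ioo (-(z / 4)) (b₀ + 1) ∈ 𝓝 b₀ := Ioo_mem_nhds (by linarith) (by linarith)
  have key := hasDerivAt_integral_of_dominated_loc_of_deriv_le (μ := volume.restrict (Ioi (0 : ℝ)))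
    (F := fun b τ => Real.exp (-(z * τ)) * (1 - Real.exp (-(b * τ))) ^ 2 / τ ^ 2)
    (F' := fun b τ => 2 * Real.exp (-(z * τ)) * (1 - Real.exp (-(b * τ))) * Real.exp (-(b * τ)) / τ) (x₀ := b₀)
    (bound := fun τ => (2 * (b₀ + 1) + z) * Real.exp (-(z / 2) * τ)) hs
    (Eventually.of_forall fun b => (continuousOn_frullaniSq_integrand z b).aestronglyMeasurable measurableSet_Ioi)
    (integrableOn_frullaniSq_integrand hz hb₀)
    ((continuousOn_frullaniSq_deriv z b₀).aestronglyMeasurable measurableSet_Ioi)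
    ?_ ((integrableOn_exp_mul_Ioi (by linarith : -(z / 2) < 0) 0).const_mul _) ?_
  · have hval : ∫ τ in Ioi (0 : ℝ), 2 * Real.exp (-(z * τ)) * (1 - Real.exp (-(b₀ * τ))) * Real.exp (-(b₀ * τ)) / τ
        = 2 * Real.log ((z + 2 * b₀) / (z + b₀)) := by
      have e : (fun τ : ℝ => 2 * Real.exp (-(z * τ)) * (1 - Real.exp (-(b₀ * τ))) * Real.exp (-(b₀ * τ)) / τ) =
          fun τ => 2 * (Real.exp (-((z + b₀) * τ)) * (1 - Real.exp (-(b₀ * τ))) / τ) := by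
        funext τ
        have : Real.exp (-(z * τ)) * Real.exp (-(b₀ * τ)) = Real.exp (-((z + b₀) * τ)) := by
          rw [← Real.exp_add]; ring_nf
        rw [← this]; ring
      rw [e, MeasureTheory.integral_const_mul, integral_frullani_exp (by linarith : 0 < z + b₀) hb₀]
      ring_nf
    rw [hval] at key
    exact key.2
  · refine (ae_restrict_mem measurableSet_Ioi).mono fun τ hτ b hb => ?_
    exact norm_frullaniSq_deriv_le hz (by linarith : (0 : ℝ) ≤ b₀ + 1) hb.1 hb.2.le (mem_Ioi.mp hτ)
  · refine (ae_restrict_mem measurableSet_Ioi).mono fun τ hτ b _ => ?_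
    exact hasDerivAt_frullaniSq_integrand z (ne_of_gt hτ) b

/-- **Squared Frullani.** `∫₀^∞ e^{−zτ}(1 − e^{−aτ})²/τ² dτ = (z+2a)log(z+2a) − 2(z+a)log(z+a) + z log z`
(`z > 0`, `a ≥ 0`). -/
theorem integral_frullani_sq {z : ℝ} (hz : 0 < z) {a : ℝ} (ha : 0 ≤ a) :
    ∫ τ in Ioi (0 : ℝ), Real.exp (-(z * τ)) * (1 - Real.exp (-(a * τ))) ^ 2 / τ ^ 2 =
      (z + 2 * a) * Real.log (z + 2 * a) - 2 * (z + a) * Real.log (z + a) + z * Real.log z := by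
  set G : ℝ → ℝ := fun b => ∫ τ in Ioi (0 : ℝ), Real.exp (-(z * τ)) * (1 - Real.exp (-(b * τ))) ^ 2 / τ ^ 2
    with hG
  have hG0 : G 0 = 0 := by simp [hG]
  have hderiv : ∀ b ∈ uIcc (0 : ℝ) a, HasDerivAt G (2 * Real.log ((z + 2 * b) / (z + b))) b := by
    intro b hb
    rw [uIcc_of_le ha] at hb
    exact hasDerivAt_frullaniSq hz hb.1
  have hcont : ContinuousOn (fun b : ℝ => 2 * Real.log ((z + 2 * b) / (z + b))) (uIcc 0 a) := by
    rw [uIcc_of_le ha]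
    refine ContinuousOn.mul continuousOn_const (ContinuousOn.log ?_ fun b hb => ?_)
    · exact ContinuousOn.div (by fun_prop) (by fun_prop) fun b hb => by have := hb.1; linarith
    · have := hb.1; positivity
  have hFTC := integral_eq_sub_of_hasDerivAt hderiv (hcont.intervalIntegrable)
  -- the antiderivative H(b) = (z+2b)log(z+2b) − 2(z+b)log(z+b)
  have hH : ∫ b in (0 : ℝ)..a, 2 * Real.log ((z + 2 * b) / (z + b)) =
      ((z + 2 * a) * Real.log (z + 2 * a) - 2 * ((z + a) * Real.log (z + a)))
        - ((z + 2 * 0) * Real.log (z + 2 * 0) - 2 * ((z + 0) * Real.log (z + 0))) := by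
    refine integral_eq_sub_of_hasDerivAt
      (f := fun b : ℝ => (z + 2 * b) * Real.log (z + 2 * b) - 2 * ((z + b) * Real.log (z + b)))
      (fun b hb => ?_) (hcont.intervalIntegrable)
    rw [uIcc_of_le ha] at hb
    have h1 : 0 < z + 2 * b := by have := hb.1; linarith
    have h2 : 0 < z + b := by have := hb.1; linarith
    have d1 : HasDerivAt (fun b : ℝ => z + 2 * b) 2 b := by
      simpa using ((hasDerivAt_id' b).const_mul (2 : ℝ)).const_add z
    have d2 : HasDerivAt (fun b : ℝ => z + b) 1 b := by simpa using (hasDerivAt_id' b).const_add z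
    have e1 := d1.fun_mul (d1.log h1.ne')
    have e2 := (d2.fun_mul (d2.log h2.ne')).const_mul (2 : ℝ)
    have e3 := e1.fun_sub e2
    refine e3.congr_deriv ?_
    rw [Real.log_div h1.ne' h2.ne']
    field_simp
    ring
  have : G a = (z + 2 * a) * Real.log (z + 2 * a) - 2 * (z + a) * Real.log (z + a) + z * Real.log z := by
    have h := hFTC
    rw [hH, hG0] at h
    simp only [mul_zero, add_zero] at h
    linear_combination -h
  exact this

/-! ## The window law's Laplace transform -/

/-- **`T₁(z)` in closed form** (CONTINUUM-LIMIT 23.2 / PROPOSITION R): for `z > 0`,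
`∫₀^∞ e^{−zτ}[(1 − e^{−2τ})/τ − (1 − e^{−τ})²/τ²] dτ = log((z+2)/z) − [(z+2)log(z+2) − 2(z+1)log(z+1) + z log z]`.
The bracket `(1 − e^{−2τ})/τ − (1 − e^{−τ})²/τ²` is THEOREM C's `g(τ) = (τ − 1 + 2e^{−τ} − (1+τ)e^{−2τ})/τ²`. -/
theorem integral_exp_mul_window_eq {z : ℝ} (hz : 0 < z) :
    ∫ τ in Ioi (0 : ℝ), Real.exp (-(z * τ)) *
        ((1 - Real.exp (-(2 * τ))) / τ - (1 - Real.exp (-(1 * τ))) ^ 2 / τ ^ 2) =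
      Real.log ((z + 2) / z) - ((z + 2) * Real.log (z + 2) - 2 * (z + 1) * Real.log (z + 1) + z * Real.log z) := by
  have h1 := integral_frullani_exp hz (by norm_num : (0 : ℝ) ≤ 2)
  have h2 := integral_frullani_sq hz (by norm_num : (0 : ℝ) ≤ 1)
  have i1 := integrableOn_frullani_integrand hz (by norm_num : (0 : ℝ) ≤ 2)
  have i2 := integrableOn_frullaniSq_integrand hz (by norm_num : (0 : ℝ) ≤ 1)
  have e : (fun τ : ℝ => Real.exp (-(z * τ)) *
        ((1 - Real.exp (-(2 * τ))) / τ - (1 - Real.exp (-(1 * τ))) ^ 2 / τ ^ 2)) =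
      fun τ => Real.exp (-(z * τ)) * (1 - Real.exp (-(2 * τ))) / τ
        - Real.exp (-(z * τ)) * (1 - Real.exp (-(1 * τ))) ^ 2 / τ ^ 2 := by
    funext τ; ring
  rw [e, integral_sub i1 i2, h1, h2]
  ring_nf

end Summit.RiemannHypothesis.RiemannHypothesis.Theorems.IntegerScrew

end
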